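import Literature.Combinatorics.Enumerative.AperyGaussCongruences
import HarnessLib

/-!
# Straub's multivariate supercongruences at `r = 1`, proved: `A(p𝐧) ≡ A(𝐧)`, `B(p𝐧) ≡ B(𝐧)`, and Osburn–Sahu–Straub's `𝒮(mp;A,B,C) ≡ 𝒮(m;A,B,C) (mod p³)`

Topic `Literature/Combinatorics/Enumerative`.  PROOF FILE: sorry-free theorems only — no definition, no named fact.
It proves the case `r = 1` (for `𝐧` with non-negative entries) of two named facts of
`MultivariateAperyNumbers.lean`: `theorem12` (A. Straub, *Multivariate Apéry numbers and supercongruences of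
rational functions*, Algebra & Number Theory **8** (2014) [Straub2014], Theorem 1.2 (9):
`A(p^r 𝐧) ≡ A(p^{r−1} 𝐧) (mod p^{3r})` for the coefficients (8)
`A(n₁,n₂,n₃,n₄) = Σ_k C(n₁,k) C(n₃,k) C(n₁+n₂−k,n₁) C(n₃+n₄−k,n₃)` of `1/((1−x₁−x₂)(1−x₃−x₄) − x₁x₂x₃x₄)`) and
`example34_supercongruence` ((25): the same for the coefficients `B(n₁,n₂,n₃) = Σ_k C(n₁,k) C(n₁+n₂−k,n₁) C(n₃,k)`
of `1/((1−x₁−x₂)(1−x₃) − x₁x₂x₃)`, whose diagonal are Apéry's `ζ(2)` numbers), and the case `r = 1` of the named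
fact `AperyGaussCongruences.oss2016_theorem12` (R. Osburn, B. Sahu, A. Straub, *Supercongruences for sporadic
sequences*, Proc. Edinb. Math. Soc. **59** (2016) [OsburnSahuStraub2016], Theorem 1.2 (12):
`𝒮(mp^r; A,B,C) ≡ 𝒮(mp^{r−1}; A,B,C) (mod p^{3r})` for `𝒮(n; A,B,C) = Σ_k C(n,k)^A C(n+k,k)^B C(2k,n)^C`, `A ≥ 2`).

## What is proved

* **`straubA_mul_prime_modEq`**: for every prime `p ≥ 5` and all `n₁,n₂,n₃,n₄ ≥ 0`,
  `A(pn₁,pn₂,pn₃,pn₄) ≡ A(n₁,n₂,n₃,n₄) (mod p³)`; `theorem12_r_one` restates it in the shape of the fact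
  `MultivariateAperyNumbers.theorem12` at `r = 1`.  On the diagonal this is Gessel's theorem (the tree's
  `AperySupercongruences.aperyNumber_modEq_mul_prime`); off the diagonal it is new to the tree.
* **`straubB_mul_prime_modEq`**, `example34_supercongruence_r_one`: the same for `B` ((25) at `r = 1`).
* **`ossS_mul_prime_modEq`**: for every prime `p ≥ 5`, all `A ≥ 2`, `B, C ≥ 0` and every `m`,
  `𝒮(mp; A,B,C) ≡ 𝒮(m; A,B,C) (mod p³)` — [OsburnSahuStraub2016] Theorem 1.2 at `r = 1` (the tree had the case
  `A = 2`, `C = 0`: `AperySupercongruences.genApery_two_modEq_mul_prime`); `oss2016_theorem12_r_one` restates it in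
  the shape of the fact; `s7_mul_prime_modEq` is the case `(2,1,1)`: `s₇(mp) ≡ s₇(m) (mod p³)`, `p ≥ 5` (their
  Conjecture 1.1 (9) for such `p`).  For `A ≥ 3` every off-digit term vanishes mod `p³`; for `A = 2` the factor
  `C(2K, mp)` reduces (Lucas) to `C(2j, m)` or `C(2j+1, m)` according as `2i < p` or not, and BOTH half sums
  `Σ_{0<i≤(p−1)/2} i⁻²`, `Σ_{(p−1)/2<i<p} i⁻²` vanish mod `p` (`sum_Ico_half_inv_sq_eq_zero`, by `i ↦ p − i`).

## Route (Gessel's two blocks, as in the tree's `AperySupercongruences`, not Straub's uniform-in-`r` argument)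

Split `A(p𝐧) = Σ_{K ≤ pn₁} T(K)` into the digit terms `K = jp` — four (resp. three) applications of the
Ljunggren–Jacobsthal congruence `C(ap,bp) ≡ C(a,b) (mod p³)` (`Ljunggren.choose_mul_prime`) — and the off-digit
blocks `K = jp + i`, `0 < i < p`, `j < n₁`: by the absorption identity `K·C(pn,K) = pn·C(pn−1,K−1)` each term is
`p²·K⁻²·(n₁n₃·C(pn₁−1,K−1)C(pn₃−1,K−1)·C(p(n₁+n₂)−K,pn₁)C(p(n₃+n₄)−K,pn₃))` in `ℤ/p³`, and modulo `p` the bracket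
is independent of `i` up to the sign `((−1)^{i−1})² = 1` (Lucas: `AperyLucasCongruences.cast_choose_digit`,
`AperySupercongruences.cast_choose_prime_sub_one`), so the block is `p² · c · Σ_{0<i<p} i⁻² ≡ 0 (mod p³)` by
`AperySupercongruences.sum_Ico_inv_sq_eq_zero` (`p > 3`).  [cite: Gessel1982, Thm 3 (proof)] for the method;
[cite: Straub2014, Theorem 1.2, (25)] and [cite: OsburnSahuStraub2016, Theorem 1.2] for the statements.  Straub's own proof (Lemmas 5.3–5.6, uniform in `r`)
needs Jacobsthal's congruence modulo `p^{r+s+min(r,s)}`, which the tree does not have beyond `p³`.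
-/

open Finset

namespace Literature.Combinatorics.Enumerative.MultivariateAperySupercongruenceProofs

open AperyLucasCongruences (cast_choose_digit)
open AperySupercongruences (cast_choose_prime_sub_one sum_Ico_inv_sq_eq_zero)
open Literature.NumberTheory.Congruences (Ljunggren.choose_mul_prime)
open MultivariateAperyNumbers (straubA straubB)
open AperyGaussCongruences (ossS)
open AperyLucasCongruences (cast_choose_shift_digit)

/-- Splitting a sum over `range (k·q)` into `q`-blocks. [folklore] -/
private theorem sum_range_mul (f : ℕ → ℕ) (q : ℕ) :
    ∀ k : ℕ, ∑ x ∈ range (q * k), f x = ∑ j ∈ range k, ∑ i ∈ range q, f (j * q + i)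
  | 0 => by simp
  | k + 1 => by
      rw [Finset.sum_range_succ (fun j => ∑ i ∈ range q, f (j * q + i)) k, ← sum_range_mul f q k,
        Nat.mul_succ, Finset.sum_range_add, mul_comm k q]

section

variable {p : ℕ} [hp : Fact p.Prime]

/-! ## Lucas-type reductions modulo `p` and the `ℤ/p³ → ℤ/p` bookkeeping -/

/-- Lucas for a top index `pM − K`, `K = jp + i`, `0 < i < p`, bottom `pn`:
`C(pM − K, pn) ≡ C(M − j − 1, n) (mod p)` (both sides vanish when `M ≤ j`, unless `n = 0`). [folklore] -/
private theorem cast_choose_mul_sub (M n j i : ℕ) (hi1 : 1 ≤ i) (hip : i < p) :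
    (((p * M - (j * p + i)).choose (p * n) : ℕ) : ZMod p) = (((M - j - 1).choose n : ℕ) : ZMod p) := by
  rcases Nat.lt_or_ge j M with hjM | hjM
  · have e : p * M - (j * p + i) = (M - j - 1) * p + (p - i) := by
      have h1 : p * M = p * (M - j - 1) + p * j + p := by
        rw [← Nat.mul_add, ← Nat.mul_succ]; congr 1; omega
      rw [h1]
      have : p * (M - j - 1) + p * j + p - (j * p + i) = p * (M - j - 1) + (p - i) := by
        rw [mul_comm j p]; omega
      rw [this, mul_comm]
    rw [e, show p * n = n * p + 0 by ring, cast_choose_digit (M - j - 1) (p - i) n 0 (by omega) hp.out.pos]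
    simp
  · have e1 : p * M - (j * p + i) = 0 := by
      have : p * M ≤ p * j := Nat.mul_le_mul_left p hjM
      rw [mul_comm j p]; omega
    have e2 : M - j - 1 = 0 := by omega
    rw [e1, e2]
    rcases Nat.eq_zero_or_pos n with hn | hn
    · subst hn; simp
    · rw [Nat.choose_eq_zero_of_lt (by omega : 0 < n),
        Nat.choose_eq_zero_of_lt (Nat.mul_pos hp.out.pos hn)]

/-- Lucas for `C(pn − 1, jp + i − 1)`, `1 ≤ i < p`, `n ≥ 1`: `≡ C(n − 1, j)(−1)^{i−1} (mod p)`. [folklore] -/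
private theorem cast_choose_mul_sub_one (n j i : ℕ) (hn : 1 ≤ n) (hi1 : 1 ≤ i) (hip : i < p) :
    (((p * n - 1).choose (j * p + i - 1) : ℕ) : ZMod p) = (((n - 1).choose j : ℕ) : ZMod p) * (-1) ^ (i - 1) := by
  have hp1 : 1 ≤ p := hp.out.one_lt.le
  have e1 : p * n - 1 = (n - 1) * p + (p - 1) := by
    zify [hn, hp1, Nat.one_le_iff_ne_zero.2 (show p * n ≠ 0 from Nat.mul_ne_zero hp.out.ne_zero (by omega))]
    ring
  have e2 : j * p + i - 1 = j * p + (i - 1) := by omega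
  rw [e1, e2, cast_choose_digit (n - 1) (p - 1) j (i - 1) (by omega) (by omega),
    cast_choose_prime_sub_one (by omega)]

/-- In `ZMod (p^3)`: if the image in `ZMod p` vanishes then `p² · y = 0`. [folklore] -/
private theorem sq_mul_eq_zero_of_cast {y : ZMod (p ^ 3)}
    (hy : (ZMod.castHom (dvd_pow_self p three_ne_zero) (ZMod p)) y = 0) : (p : ZMod (p ^ 3)) ^ 2 * y = 0 := by
  haveI : NeZero (p ^ 3) := ⟨pow_ne_zero 3 hp.out.ne_zero⟩
  rw [ZMod.castHom_apply, ZMod.cast_eq_val, ZMod.natCast_eq_zero_iff] at hy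
  obtain ⟨m, hm⟩ := hy
  rw [← ZMod.natCast_zmod_val y, hm]
  push_cast
  have h3 : (p : ZMod (p ^ 3)) ^ 3 = 0 := by exact_mod_cast ZMod.natCast_self (p ^ 3)
  rw [← mul_assoc, ← pow_succ, show 2 + 1 = 3 from rfl, h3, zero_mul]


/-- `jp + i` is prime to `p` (hence to `p³`) for `0 < i < p`. [folklore] -/
private theorem coprime_block (j : ℕ) {i : ℕ} (hi1 : 1 ≤ i) (hip : i < p) : Nat.Coprime (j * p + i) p := by
  rw [Nat.coprime_comm, Nat.Prime.coprime_iff_not_dvd hp.out]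
  intro h
  have hi' : p ∣ i := (Nat.dvd_add_right (dvd_mul_left p j)).1 h
  have := Nat.le_of_dvd (by omega) hi'
  omega

/-- The image of `(jp+i)⁻¹ ∈ ZMod (p³)` in `ZMod p` is `i⁻¹`. [folklore] -/
private theorem cast_inv_block (j : ℕ) {i : ℕ} (hi1 : 1 ≤ i) (hip : i < p) :
    (ZMod.castHom (dvd_pow_self p three_ne_zero) (ZMod p)) (((j * p + i : ℕ) : ZMod (p ^ 3))⁻¹) =
      ((i : ZMod p))⁻¹ := by
  set cast1 := ZMod.castHom (dvd_pow_self p three_ne_zero) (ZMod p)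
  have hcop : Nat.Coprime (j * p + i) (p ^ 3) := (coprime_block j hi1 hip).pow_right 3
  have hKi : cast1 ((j * p + i : ℕ) : ZMod (p ^ 3)) = (i : ZMod p) := by
    rw [map_natCast]; push_cast; simp
  have h1 : ((j * p + i : ℕ) : ZMod (p ^ 3)) * ((j * p + i : ℕ) : ZMod (p ^ 3))⁻¹ = 1 :=
    ZMod.coe_mul_inv_eq_one _ hcop
  have h2 := congrArg cast1 h1
  rw [map_mul, map_one, hKi] at h2
  have hi0 : (i : ZMod p) ≠ 0 := by
    rw [Ne, ZMod.natCast_eq_zero_iff]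
    intro h; have := Nat.le_of_dvd (by omega) h; omega
  calc cast1 (((j * p + i : ℕ) : ZMod (p ^ 3))⁻¹)
      = (i : ZMod p)⁻¹ * ((i : ZMod p) * cast1 (((j * p + i : ℕ) : ZMod (p ^ 3))⁻¹)) := by
        rw [← mul_assoc, inv_mul_cancel₀ hi0, one_mul]
    _ = (i : ZMod p)⁻¹ := by rw [h2, mul_one]

/-! ## `A(n₁,n₂,n₃,n₄)`: Theorem 1.2 at `r = 1` -/

/-- **Off-digit blocks vanish mod `p³`**: for a prime `p > 3`, `j < n₁` and the summand
`T(K) = C(pn₁,K) C(pn₃,K) C(pn₁+pn₂−K, pn₁) C(pn₃+pn₄−K, pn₃)` of `A(p𝐧)`, `Σ_{0<i<p} T(jp+i) ≡ 0 (mod p³)`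
(Gessel's `S₂`-computation). [cite: Gessel1982, Thm 3 (proof, «S₂ ≡ 0 (mod p³)»)] [cite: Straub2014, Theorem 1.2 (r = 1)] -/
theorem offDigit_block_eq_zero (h3 : 3 < p) (n₁ n₂ n₃ n₄ : ℕ) {j : ℕ} (hj : j < n₁) :
    ((∑ i ∈ Ico 1 p, (p * n₁).choose (j * p + i) * (p * n₃).choose (j * p + i) *
        (p * n₁ + p * n₂ - (j * p + i)).choose (p * n₁) * (p * n₃ + p * n₄ - (j * p + i)).choose (p * n₃) : ℕ) :
      ZMod (p ^ 3)) = 0 := by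
  haveI : NeZero (p ^ 3) := ⟨pow_ne_zero 3 hp.out.ne_zero⟩
  rcases Nat.eq_zero_or_pos n₃ with hn3 | hn3
  · subst hn3
    have h0 : ∑ i ∈ Ico 1 p, (p * n₁).choose (j * p + i) * (p * 0).choose (j * p + i) *
        (p * n₁ + p * n₂ - (j * p + i)).choose (p * n₁) * (p * 0 + p * n₄ - (j * p + i)).choose (p * 0) = 0 := by
      apply Finset.sum_eq_zero
      intro i hi
      rw [Finset.mem_Ico] at hi
      rw [mul_zero, Nat.choose_eq_zero_of_lt (by omega : 0 < j * p + i)]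
      ring
    rw [h0, Nat.cast_zero]
  have hn1 : 1 ≤ n₁ := by omega
  set castP := ZMod.castHom (dvd_pow_self p three_ne_zero) (ZMod p) with hcastP
  -- absorption identities `K·C(pn,K) = pn·C(pn−1,K−1)`
  have habs : ∀ n, 1 ≤ n → ∀ i ∈ Ico 1 p,
      (j * p + i) * (p * n).choose (j * p + i) = p * n * (p * n - 1).choose (j * p + i - 1) := by
    intro n hn i hi
    rw [Finset.mem_Ico] at hi
    have hnp : p * n - 1 + 1 = p * n := Nat.sub_add_cancel (Nat.one_le_iff_ne_zero.2 (Nat.mul_ne_zero hp.out.ne_zero (by omega)))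
    have h := Nat.add_one_mul_choose_eq (p * n - 1) (j * p + i - 1)
    rw [hnp, show j * p + i - 1 + 1 = j * p + i by omega] at h
    rw [h, mul_comm]
  -- each term is `p² · (K⁻¹)² · (n₁ n₃ C'₁ C'₃ C₂ C₄)` in `ZMod (p³)`
  have hterm : ∀ i ∈ Ico 1 p,
      (((p * n₁).choose (j * p + i) * (p * n₃).choose (j * p + i) *
        (p * n₁ + p * n₂ - (j * p + i)).choose (p * n₁) * (p * n₃ + p * n₄ - (j * p + i)).choose (p * n₃) : ℕ) :
          ZMod (p ^ 3)) =
        (p : ZMod (p ^ 3)) ^ 2 * ((((j * p + i : ℕ) : ZMod (p ^ 3)))⁻¹ ^ 2 *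
          ((n₁ * n₃ * (p * n₁ - 1).choose (j * p + i - 1) * (p * n₃ - 1).choose (j * p + i - 1) *
            (p * n₁ + p * n₂ - (j * p + i)).choose (p * n₁) * (p * n₃ + p * n₄ - (j * p + i)).choose (p * n₃) : ℕ) :
              ZMod (p ^ 3))) := by
    intro i hi
    have hi' := hi
    rw [Finset.mem_Ico] at hi'
    set K := j * p + i with hK
    have hKu : ((K : ℕ) : ZMod (p ^ 3)) * ((K : ℕ) : ZMod (p ^ 3))⁻¹ = 1 :=
      ZMod.coe_mul_inv_eq_one _ ((coprime_block j hi'.1 hi'.2).pow_right 3)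
    have e : ∀ n, 1 ≤ n → (((p * n).choose K : ℕ) : ZMod (p ^ 3)) =
        ((p * n : ℕ) : ZMod (p ^ 3)) * (((p * n - 1).choose (K - 1) : ℕ) : ZMod (p ^ 3)) *
          ((K : ℕ) : ZMod (p ^ 3))⁻¹ := by
      intro n hn
      have h := congrArg (Nat.cast : ℕ → ZMod (p ^ 3)) (habs n hn i hi)
      simp only [Nat.cast_mul] at h
      calc (((p * n).choose K : ℕ) : ZMod (p ^ 3))
          = (((p * n).choose K : ℕ) : ZMod (p ^ 3)) * (((K : ℕ) : ZMod (p ^ 3)) * ((K : ℕ) : ZMod (p ^ 3))⁻¹) := by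
            rw [hKu, mul_one]
        _ = (((K : ℕ) : ZMod (p ^ 3)) * (((p * n).choose K : ℕ) : ZMod (p ^ 3))) * ((K : ℕ) : ZMod (p ^ 3))⁻¹ := by
            ring
        _ = _ := by rw [h]; push_cast; ring
    push_cast
    rw [e n₁ hn1, e n₃ hn3]
    push_cast
    ring
  rw [Nat.cast_sum, Finset.sum_congr rfl hterm, ← Finset.mul_sum]
  apply sq_mul_eq_zero_of_cast
  rw [map_sum]
  -- reduce every summand mod `p`
  have hred : ∀ i ∈ Ico 1 p,
      castP ((((j * p + i : ℕ) : ZMod (p ^ 3)))⁻¹ ^ 2 *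
          ((n₁ * n₃ * (p * n₁ - 1).choose (j * p + i - 1) * (p * n₃ - 1).choose (j * p + i - 1) *
            (p * n₁ + p * n₂ - (j * p + i)).choose (p * n₁) * (p * n₃ + p * n₄ - (j * p + i)).choose (p * n₃) : ℕ) :
              ZMod (p ^ 3))) =
        ((n₁ : ZMod p) * n₃ * (((n₁ - 1).choose j : ℕ) : ZMod p) * (((n₃ - 1).choose j : ℕ) : ZMod p) *
          (((n₁ + n₂ - j - 1).choose n₁ : ℕ) : ZMod p) * (((n₃ + n₄ - j - 1).choose n₃ : ℕ) : ZMod p)) *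
          ((i : ZMod p))⁻¹ ^ 2 := by
    intro i hi
    rw [Finset.mem_Ico] at hi
    rw [map_mul, map_pow, cast_inv_block j hi.1 hi.2, map_natCast]
    push_cast
    rw [cast_choose_mul_sub_one n₁ j i hn1 hi.1 hi.2, cast_choose_mul_sub_one n₃ j i hn3 hi.1 hi.2,
      ← Nat.mul_add p n₁ n₂, ← Nat.mul_add p n₃ n₄,
      cast_choose_mul_sub (n₁ + n₂) n₁ j i hi.1 hi.2, cast_choose_mul_sub (n₃ + n₄) n₃ j i hi.1 hi.2]
    have hsq : ((-1 : ZMod p) ^ (i - 1)) ^ 2 = 1 := by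
      rw [← pow_mul, mul_comm, pow_mul, neg_one_sq, one_pow]
    linear_combination ((n₁ : ZMod p) * n₃ * (((n₁ - 1).choose j : ℕ) : ZMod p) *
      (((n₃ - 1).choose j : ℕ) : ZMod p) * (((n₁ + n₂ - j - 1).choose n₁ : ℕ) : ZMod p) *
      (((n₃ + n₄ - j - 1).choose n₃ : ℕ) : ZMod p) * ((i : ZMod p))⁻¹ ^ 2) * hsq
  rw [Finset.sum_congr rfl hred, ← Finset.mul_sum, sum_Ico_inv_sq_eq_zero h3, mul_zero]

/-- **Digit terms**: `T(jp) ≡ C(n₁,j) C(n₃,j) C(n₁+n₂−j,n₁) C(n₃+n₄−j,n₃) (mod p³)` — four applications of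
`C(ap,bp) ≡ C(a,b) (mod p³)`. [cite: Gessel1982, Thm 3 (proof, «S₁»)] [cite: Straub2014, Lemma 5.3 (r = s = 1, λ = (2,2))] -/
theorem digit_term_modEq (h3 : 3 < p) (n₁ n₂ n₃ n₄ j : ℕ) :
    (((p * n₁).choose (j * p) * (p * n₃).choose (j * p) * (p * n₁ + p * n₂ - j * p).choose (p * n₁) *
        (p * n₃ + p * n₄ - j * p).choose (p * n₃) : ℕ) : ℤ) ≡
      ((n₁.choose j * n₃.choose j * (n₁ + n₂ - j).choose n₁ * (n₃ + n₄ - j).choose n₃ : ℕ) : ℤ)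
        [ZMOD (p : ℤ) ^ 3] := by
  have hP := hp.out
  have e1 : p * n₁ + p * n₂ - j * p = (n₁ + n₂ - j) * p := by
    rw [Nat.sub_mul, Nat.add_mul]; ring_nf
  have e2 : p * n₃ + p * n₄ - j * p = (n₃ + n₄ - j) * p := by
    rw [Nat.sub_mul, Nat.add_mul]; ring_nf
  rw [e1, e2, mul_comm p n₁, mul_comm p n₃]
  push_cast
  exact (((Ljunggren.choose_mul_prime hP h3 n₁ j).mul (Ljunggren.choose_mul_prime hP h3 n₃ j)).mul
    (Ljunggren.choose_mul_prime hP h3 (n₁ + n₂ - j) n₁)).mul (Ljunggren.choose_mul_prime hP h3 (n₃ + n₄ - j) n₃)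

/-- **Straub 2014, Theorem 1.2 at `r = 1` for `𝐧 ∈ ℤ_{≥0}^4`, PROVED**: for every prime `p > 3` and all
`n₁,n₂,n₃,n₄ ≥ 0`, `A(pn₁,pn₂,pn₃,pn₄) ≡ A(n₁,n₂,n₃,n₄) (mod p³)`. [cite: Straub2014, Theorem 1.2 (9), r = 1] -/
theorem straubA_mul_prime_modEq (h3 : 3 < p) (n₁ n₂ n₃ n₄ : ℕ) :
    (straubA (p * n₁) (p * n₂) (p * n₃) (p * n₄) : ℤ) ≡ straubA n₁ n₂ n₃ n₄ [ZMOD (p : ℤ) ^ 3] := by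
  have hP := hp.out
  have hdec : straubA (p * n₁) (p * n₂) (p * n₃) (p * n₄) =
      ∑ j ∈ range n₁, ((p * n₁).choose (j * p) * (p * n₃).choose (j * p) *
          (p * n₁ + p * n₂ - j * p).choose (p * n₁) * (p * n₃ + p * n₄ - j * p).choose (p * n₃) +
        ∑ i ∈ Ico 1 p, (p * n₁).choose (j * p + i) * (p * n₃).choose (j * p + i) *
          (p * n₁ + p * n₂ - (j * p + i)).choose (p * n₁) * (p * n₃ + p * n₄ - (j * p + i)).choose (p * n₃)) +
      (p * n₁).choose (p * n₁) * (p * n₃).choose (p * n₁) * (p * n₁ + p * n₂ - p * n₁).choose (p * n₁) *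
        (p * n₃ + p * n₄ - p * n₁).choose (p * n₃) := by
    unfold straubA
    rw [Finset.sum_range_succ, sum_range_mul _ p n₁]
    congr 1
    refine Finset.sum_congr rfl fun j _ => ?_
    rw [Finset.range_eq_Ico, Finset.sum_eq_sum_Ico_succ_bot hP.pos, add_zero]
  have hdec' : straubA n₁ n₂ n₃ n₄ =
      ∑ j ∈ range n₁, n₁.choose j * n₃.choose j * (n₁ + n₂ - j).choose n₁ * (n₃ + n₄ - j).choose n₃ +
        n₁.choose n₁ * n₃.choose n₁ * (n₁ + n₂ - n₁).choose n₁ * (n₃ + n₄ - n₁).choose n₃ := by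
    unfold straubA
    rw [Finset.sum_range_succ]
  rw [hdec, hdec']
  push_cast
  refine Int.ModEq.add (Int.ModEq.sum fun j hj => ?_) ?_
  · have hblock := offDigit_block_eq_zero (p := p) h3 n₁ n₂ n₃ n₄ (Finset.mem_range.1 hj)
    rw [ZMod.natCast_eq_zero_iff] at hblock
    have hblock' : ((∑ i ∈ Ico 1 p, (p * n₁).choose (j * p + i) * (p * n₃).choose (j * p + i) *
        (p * n₁ + p * n₂ - (j * p + i)).choose (p * n₁) * (p * n₃ + p * n₄ - (j * p + i)).choose (p * n₃) : ℕ) : ℤ)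
          ≡ 0 [ZMOD (p : ℤ) ^ 3] := by
      rw [Int.modEq_zero_iff_dvd, ← Nat.cast_pow]
      exact Int.natCast_dvd_natCast.2 hblock
    push_cast at hblock'
    have h := (digit_term_modEq (p := p) h3 n₁ n₂ n₃ n₄ j).add hblock'
    rwa [add_zero] at h
  · have h := digit_term_modEq (p := p) h3 n₁ n₂ n₃ n₄ n₁
    rw [mul_comm n₁ p] at h
    exact h

/-- The case `r = 1` of the named fact `MultivariateAperyNumbers.theorem12`, in its exact shape.
[cite: Straub2014, Theorem 1.2 (9), r = 1] -/
theorem theorem12_r_one (p : ℕ) (hpr : p.Prime) (h5 : 5 ≤ p) (n₁ n₂ n₃ n₄ : ℕ) :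
    (straubA (p ^ 1 * n₁) (p ^ 1 * n₂) (p ^ 1 * n₃) (p ^ 1 * n₄) : ℤ) ≡
      straubA (p ^ (1 - 1) * n₁) (p ^ (1 - 1) * n₂) (p ^ (1 - 1) * n₃) (p ^ (1 - 1) * n₄) [ZMOD (p : ℤ) ^ (3 * 1)] := by
  haveI : Fact p.Prime := ⟨hpr⟩
  simpa using straubA_mul_prime_modEq (p := p) (by omega) n₁ n₂ n₃ n₄


/-! ## `B(n₁,n₂,n₃)`: (25) at `r = 1` -/

/-- Off-digit blocks of `B(p𝐧)` vanish mod `p³`: for `p > 3`, `j < n₁`,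
`Σ_{0<i<p} C(pn₁,K) C(pn₁+pn₂−K,pn₁) C(pn₃,K) ≡ 0 (mod p³)`, `K = jp+i`.
[cite: Gessel1982, Thm 3 (proof, «S₂»)] [cite: Straub2014, (25) (r = 1)] -/
theorem offDigit_blockB_eq_zero (h3 : 3 < p) (n₁ n₂ n₃ : ℕ) {j : ℕ} (hj : j < n₁) :
    ((∑ i ∈ Ico 1 p, (p * n₁).choose (j * p + i) * (p * n₁ + p * n₂ - (j * p + i)).choose (p * n₁) *
        (p * n₃).choose (j * p + i) : ℕ) : ZMod (p ^ 3)) = 0 := by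
  haveI : NeZero (p ^ 3) := ⟨pow_ne_zero 3 hp.out.ne_zero⟩
  rcases Nat.eq_zero_or_pos n₃ with hn3 | hn3
  · subst hn3
    have h0 : ∑ i ∈ Ico 1 p, (p * n₁).choose (j * p + i) * (p * n₁ + p * n₂ - (j * p + i)).choose (p * n₁) *
        (p * 0).choose (j * p + i) = 0 := by
      apply Finset.sum_eq_zero
      intro i hi
      rw [Finset.mem_Ico] at hi
      rw [mul_zero, Nat.choose_eq_zero_of_lt (by omega : 0 < j * p + i)]
      ring
    rw [h0, Nat.cast_zero]
  have hn1 : 1 ≤ n₁ := by omega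
  set castP := ZMod.castHom (dvd_pow_self p three_ne_zero) (ZMod p) with hcastP
  have habs : ∀ n, 1 ≤ n → ∀ i ∈ Ico 1 p,
      (j * p + i) * (p * n).choose (j * p + i) = p * n * (p * n - 1).choose (j * p + i - 1) := by
    intro n hn i hi
    rw [Finset.mem_Ico] at hi
    have hnp : p * n - 1 + 1 = p * n := Nat.sub_add_cancel (Nat.one_le_iff_ne_zero.2 (Nat.mul_ne_zero hp.out.ne_zero (by omega)))
    have h := Nat.add_one_mul_choose_eq (p * n - 1) (j * p + i - 1)
    rw [hnp, show j * p + i - 1 + 1 = j * p + i by omega] at h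
    rw [h, mul_comm]
  have hterm : ∀ i ∈ Ico 1 p,
      (((p * n₁).choose (j * p + i) * (p * n₁ + p * n₂ - (j * p + i)).choose (p * n₁) *
        (p * n₃).choose (j * p + i) : ℕ) : ZMod (p ^ 3)) =
        (p : ZMod (p ^ 3)) ^ 2 * ((((j * p + i : ℕ) : ZMod (p ^ 3)))⁻¹ ^ 2 *
          ((n₁ * n₃ * (p * n₁ - 1).choose (j * p + i - 1) * (p * n₃ - 1).choose (j * p + i - 1) *
            (p * n₁ + p * n₂ - (j * p + i)).choose (p * n₁) : ℕ) : ZMod (p ^ 3))) := by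
    intro i hi
    have hi' := hi
    rw [Finset.mem_Ico] at hi'
    set K := j * p + i with hK
    have hKu : ((K : ℕ) : ZMod (p ^ 3)) * ((K : ℕ) : ZMod (p ^ 3))⁻¹ = 1 :=
      ZMod.coe_mul_inv_eq_one _ ((coprime_block j hi'.1 hi'.2).pow_right 3)
    have e : ∀ n, 1 ≤ n → (((p * n).choose K : ℕ) : ZMod (p ^ 3)) =
        ((p * n : ℕ) : ZMod (p ^ 3)) * (((p * n - 1).choose (K - 1) : ℕ) : ZMod (p ^ 3)) *
          ((K : ℕ) : ZMod (p ^ 3))⁻¹ := by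
      intro n hn
      have h := congrArg (Nat.cast : ℕ → ZMod (p ^ 3)) (habs n hn i hi)
      simp only [Nat.cast_mul] at h
      calc (((p * n).choose K : ℕ) : ZMod (p ^ 3))
          = (((p * n).choose K : ℕ) : ZMod (p ^ 3)) * (((K : ℕ) : ZMod (p ^ 3)) * ((K : ℕ) : ZMod (p ^ 3))⁻¹) := by
            rw [hKu, mul_one]
        _ = (((K : ℕ) : ZMod (p ^ 3)) * (((p * n).choose K : ℕ) : ZMod (p ^ 3))) * ((K : ℕ) : ZMod (p ^ 3))⁻¹ := by
            ring
        _ = _ := by rw [h]; push_cast; ring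
    push_cast
    rw [e n₁ hn1, e n₃ hn3]
    push_cast
    ring
  rw [Nat.cast_sum, Finset.sum_congr rfl hterm, ← Finset.mul_sum]
  apply sq_mul_eq_zero_of_cast
  rw [map_sum]
  have hred : ∀ i ∈ Ico 1 p,
      castP ((((j * p + i : ℕ) : ZMod (p ^ 3)))⁻¹ ^ 2 *
          ((n₁ * n₃ * (p * n₁ - 1).choose (j * p + i - 1) * (p * n₃ - 1).choose (j * p + i - 1) *
            (p * n₁ + p * n₂ - (j * p + i)).choose (p * n₁) : ℕ) : ZMod (p ^ 3))) =
        ((n₁ : ZMod p) * n₃ * (((n₁ - 1).choose j : ℕ) : ZMod p) * (((n₃ - 1).choose j : ℕ) : ZMod p) *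
          (((n₁ + n₂ - j - 1).choose n₁ : ℕ) : ZMod p)) * ((i : ZMod p))⁻¹ ^ 2 := by
    intro i hi
    rw [Finset.mem_Ico] at hi
    rw [map_mul, map_pow, cast_inv_block j hi.1 hi.2, map_natCast]
    push_cast
    rw [cast_choose_mul_sub_one n₁ j i hn1 hi.1 hi.2, cast_choose_mul_sub_one n₃ j i hn3 hi.1 hi.2,
      ← Nat.mul_add p n₁ n₂, cast_choose_mul_sub (n₁ + n₂) n₁ j i hi.1 hi.2]
    have hsq : ((-1 : ZMod p) ^ (i - 1)) ^ 2 = 1 := by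
      rw [← pow_mul, mul_comm, pow_mul, neg_one_sq, one_pow]
    linear_combination ((n₁ : ZMod p) * n₃ * (((n₁ - 1).choose j : ℕ) : ZMod p) *
      (((n₃ - 1).choose j : ℕ) : ZMod p) * (((n₁ + n₂ - j - 1).choose n₁ : ℕ) : ZMod p) *
      ((i : ZMod p))⁻¹ ^ 2) * hsq
  rw [Finset.sum_congr rfl hred, ← Finset.mul_sum, sum_Ico_inv_sq_eq_zero h3, mul_zero]

/-- Digit terms of `B(p𝐧)`: `C(pn₁,jp) C(pn₁+pn₂−jp,pn₁) C(pn₃,jp) ≡ C(n₁,j) C(n₁+n₂−j,n₁) C(n₃,j) (mod p³)`.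
[cite: Gessel1982, Thm 3 (proof, «S₁»)] [cite: Straub2014, Lemma 5.3 (r = s = 1, λ = (2,1))] -/
theorem digit_termB_modEq (h3 : 3 < p) (n₁ n₂ n₃ j : ℕ) :
    (((p * n₁).choose (j * p) * (p * n₁ + p * n₂ - j * p).choose (p * n₁) * (p * n₃).choose (j * p) : ℕ) : ℤ) ≡
      ((n₁.choose j * (n₁ + n₂ - j).choose n₁ * n₃.choose j : ℕ) : ℤ) [ZMOD (p : ℤ) ^ 3] := by
  have hP := hp.out
  have e1 : p * n₁ + p * n₂ - j * p = (n₁ + n₂ - j) * p := by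
    rw [Nat.sub_mul, Nat.add_mul]; ring_nf
  rw [e1, mul_comm p n₁, mul_comm p n₃]
  push_cast
  exact ((Ljunggren.choose_mul_prime hP h3 n₁ j).mul (Ljunggren.choose_mul_prime hP h3 (n₁ + n₂ - j) n₁)).mul
    (Ljunggren.choose_mul_prime hP h3 n₃ j)

/-- **Straub 2014, (25) at `r = 1` for `𝐧 ∈ ℤ_{≥0}^3`, PROVED**: for every prime `p > 3` and all `n₁,n₂,n₃ ≥ 0`,
`B(pn₁,pn₂,pn₃) ≡ B(n₁,n₂,n₃) (mod p³)` (on the diagonal: Coster's `ζ(2)` supercongruence at `r = 1`).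
[cite: Straub2014, Example 3.4 (25), r = 1] -/
theorem straubB_mul_prime_modEq (h3 : 3 < p) (n₁ n₂ n₃ : ℕ) :
    (straubB (p * n₁) (p * n₂) (p * n₃) : ℤ) ≡ straubB n₁ n₂ n₃ [ZMOD (p : ℤ) ^ 3] := by
  have hP := hp.out
  have hdec : straubB (p * n₁) (p * n₂) (p * n₃) =
      ∑ j ∈ range n₁, ((p * n₁).choose (j * p) * (p * n₁ + p * n₂ - j * p).choose (p * n₁) * (p * n₃).choose (j * p) +
        ∑ i ∈ Ico 1 p, (p * n₁).choose (j * p + i) * (p * n₁ + p * n₂ - (j * p + i)).choose (p * n₁) *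
          (p * n₃).choose (j * p + i)) +
      (p * n₁).choose (p * n₁) * (p * n₁ + p * n₂ - p * n₁).choose (p * n₁) * (p * n₃).choose (p * n₁) := by
    unfold straubB
    rw [Finset.sum_range_succ, sum_range_mul _ p n₁]
    congr 1
    refine Finset.sum_congr rfl fun j _ => ?_
    rw [Finset.range_eq_Ico, Finset.sum_eq_sum_Ico_succ_bot hP.pos, add_zero]
  have hdec' : straubB n₁ n₂ n₃ =
      ∑ j ∈ range n₁, n₁.choose j * (n₁ + n₂ - j).choose n₁ * n₃.choose j +
        n₁.choose n₁ * (n₁ + n₂ - n₁).choose n₁ * n₃.choose n₁ := by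
    unfold straubB
    rw [Finset.sum_range_succ]
  rw [hdec, hdec']
  push_cast
  refine Int.ModEq.add (Int.ModEq.sum fun j hj => ?_) ?_
  · have hblock := offDigit_blockB_eq_zero (p := p) h3 n₁ n₂ n₃ (Finset.mem_range.1 hj)
    rw [ZMod.natCast_eq_zero_iff] at hblock
    have hblock' : ((∑ i ∈ Ico 1 p, (p * n₁).choose (j * p + i) * (p * n₁ + p * n₂ - (j * p + i)).choose (p * n₁) *
        (p * n₃).choose (j * p + i) : ℕ) : ℤ) ≡ 0 [ZMOD (p : ℤ) ^ 3] := by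
      rw [Int.modEq_zero_iff_dvd, ← Nat.cast_pow]
      exact Int.natCast_dvd_natCast.2 hblock
    push_cast at hblock'
    have h := (digit_termB_modEq (p := p) h3 n₁ n₂ n₃ j).add hblock'
    rwa [add_zero] at h
  · have h := digit_termB_modEq (p := p) h3 n₁ n₂ n₃ n₁
    rw [mul_comm n₁ p] at h
    exact h

/-- The case `r = 1` of the named fact `MultivariateAperyNumbers.example34_supercongruence`, in its exact shape.
[cite: Straub2014, Example 3.4 (25), r = 1] -/
theorem example34_supercongruence_r_one (p : ℕ) (hpr : p.Prime) (h5 : 5 ≤ p) (n₁ n₂ n₃ : ℕ) :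
    (straubB (p ^ 1 * n₁) (p ^ 1 * n₂) (p ^ 1 * n₃) : ℤ) ≡
      straubB (p ^ (1 - 1) * n₁) (p ^ (1 - 1) * n₂) (p ^ (1 - 1) * n₃) [ZMOD (p : ℤ) ^ (3 * 1)] := by
  haveI : Fact p.Prime := ⟨hpr⟩
  simpa using straubB_mul_prime_modEq (p := p) (by omega) n₁ n₂ n₃

/-! ## Osburn–Sahu–Straub's `𝒮(n; A,B,C)`: Theorem 1.2 at `r = 1` -/

/-- Splitting a sum over `range (k·q)` into `q`-blocks (second form). [folklore] -/
private theorem sum_range_mul' (f : ℕ → ℕ) (q : ℕ) :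
    ∀ k : ℕ, ∑ x ∈ range (k * q), f x = ∑ j ∈ range k, ∑ i ∈ range q, f (j * q + i)
  | 0 => by simp
  | k + 1 => by
      rw [Finset.sum_range_succ (fun j => ∑ i ∈ range q, f (j * q + i)) k, ← sum_range_mul' f q k,
        add_mul, one_mul, Finset.sum_range_add]

/-- The two half sums `Σ_{0<i≤(p−1)/2} i⁻²` and `Σ_{(p−1)/2<i<p} i⁻²` vanish in `ZMod p` (`p > 3`).
[cite: Gessel1982, Thm 3 (proof: «Σ 1/i² ≡ 0»)] -/
theorem sum_Ico_half_inv_sq_eq_zero (h3 : 3 < p) :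
    ∑ i ∈ Ico 1 (p / 2 + 1), ((i : ZMod p)⁻¹) ^ 2 = 0 ∧ ∑ i ∈ Ico (p / 2 + 1) p, ((i : ZMod p)⁻¹) ^ 2 = 0 := by
  have hP := hp.out
  have hp2 : p % 2 = 1 := Nat.odd_iff.mp (hP.odd_of_ne_two (by omega))
  set h := p / 2 with hh
  have hph : p = 2 * h + 1 := by omega
  have hS := sum_Ico_inv_sq_eq_zero (p := p) h3
  rw [← Finset.sum_Ico_consecutive _ (show 1 ≤ h + 1 by omega) (show h + 1 ≤ p by omega)] at hS
  -- the upper half equals the lower half by `i ↦ p − i`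
  have hrefl : ∑ i ∈ Ico (h + 1) p, ((i : ZMod p)⁻¹) ^ 2 = ∑ i ∈ Ico 1 (h + 1), ((i : ZMod p)⁻¹) ^ 2 := by
    refine Finset.sum_nbij' (fun i => p - i) (fun i => p - i) ?_ ?_ ?_ ?_ ?_
    · intro i hi; rw [Finset.mem_Ico] at hi ⊢; omega
    · intro i hi; rw [Finset.mem_Ico] at hi ⊢; omega
    · intro i hi; rw [Finset.mem_Ico] at hi; omega
    · intro i hi; rw [Finset.mem_Ico] at hi; omega
    · intro i hi
      rw [Finset.mem_Ico] at hi
      rw [Nat.cast_sub (by omega : i ≤ p), ZMod.natCast_self, zero_sub, inv_pow, inv_pow, neg_sq]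
  rw [hrefl, ← two_mul] at hS
  have h2 : (2 : ZMod p) ≠ 0 := by
    have : ((2 : ℕ) : ZMod p) ≠ 0 := by
      rw [Ne, ZMod.natCast_eq_zero_iff]
      intro hd; have := Nat.le_of_dvd two_pos hd; omega
    exact_mod_cast this
  have hH : ∑ i ∈ Ico 1 (h + 1), ((i : ZMod p)⁻¹) ^ 2 = 0 := (mul_eq_zero.mp hS).resolve_left h2
  exact ⟨hH, hrefl.trans hH⟩


/-- Off-digit blocks of `𝒮(mp; A,B,C)` vanish mod `p³` (`A ≥ 2`, `p > 3`, `j < m`):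
`Σ_{0<i<p} C(mp,K)^A C(mp+K,K)^B C(2K,mp)^C ≡ 0 (mod p³)`, `K = jp + i`.  For `A ≥ 3` every term vanishes; for
`A = 2` the bracket modulo `p` depends on `i` only through `[2i < p]` (Lucas for `C(2K, mp)`), and both half sums
`Σ i⁻²` vanish. [cite: OsburnSahuStraub2016, Theorem 1.2 (r = 1)] [cite: Gessel1982, Thm 3 (proof, «S₂»)] -/
theorem offDigit_blockS_eq_zero (h3 : 3 < p) {A : ℕ} (hA : 2 ≤ A) (B C m : ℕ) {j : ℕ} (hj : j < m) :
    ((∑ i ∈ Ico 1 p, (m * p).choose (j * p + i) ^ A * (m * p + (j * p + i)).choose (j * p + i) ^ B *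
        (2 * (j * p + i)).choose (m * p) ^ C : ℕ) : ZMod (p ^ 3)) = 0 := by
  haveI : NeZero (p ^ 3) := ⟨pow_ne_zero 3 hp.out.ne_zero⟩
  have hP := hp.out
  obtain ⟨A', rfl⟩ : ∃ A', A = A' + 2 := ⟨A - 2, by omega⟩
  have hm : 1 ≤ m := by omega
  set castP := ZMod.castHom (dvd_pow_self p three_ne_zero) (ZMod p) with hcastP
  have hmp : m * p - 1 + 1 = m * p := Nat.sub_add_cancel (Nat.one_le_iff_ne_zero.2 (Nat.mul_ne_zero (by omega) hP.ne_zero))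
  -- absorption `K·C(mp,K) = mp·C(mp−1,K−1)`
  have habs : ∀ i ∈ Ico 1 p,
      (j * p + i) * (m * p).choose (j * p + i) = m * p * (m * p - 1).choose (j * p + i - 1) := by
    intro i hi
    rw [Finset.mem_Ico] at hi
    have h := Nat.add_one_mul_choose_eq (m * p - 1) (j * p + i - 1)
    rw [hmp, show j * p + i - 1 + 1 = j * p + i by omega] at h
    rw [h, mul_comm]
  have hterm : ∀ i ∈ Ico 1 p,
      (((m * p).choose (j * p + i) ^ (A' + 2) * (m * p + (j * p + i)).choose (j * p + i) ^ B *
        (2 * (j * p + i)).choose (m * p) ^ C : ℕ) : ZMod (p ^ 3)) =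
        (p : ZMod (p ^ 3)) ^ 2 * ((p : ZMod (p ^ 3)) ^ A' *
          (((m : ZMod (p ^ 3)) * (((m * p - 1).choose (j * p + i - 1) : ℕ) : ZMod (p ^ 3)) *
            (((j * p + i : ℕ) : ZMod (p ^ 3)))⁻¹) ^ (A' + 2) *
          ((((m * p + (j * p + i)).choose (j * p + i) : ℕ) : ZMod (p ^ 3)) ^ B *
            ((((2 * (j * p + i)).choose (m * p) : ℕ) : ZMod (p ^ 3))) ^ C))) := by
    intro i hi
    have hi' := hi
    rw [Finset.mem_Ico] at hi'
    set K := j * p + i with hK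
    have hKu : ((K : ℕ) : ZMod (p ^ 3)) * ((K : ℕ) : ZMod (p ^ 3))⁻¹ = 1 :=
      ZMod.coe_mul_inv_eq_one _ ((coprime_block j hi'.1 hi'.2).pow_right 3)
    have e : (((m * p).choose K : ℕ) : ZMod (p ^ 3)) =
        ((m * p : ℕ) : ZMod (p ^ 3)) * (((m * p - 1).choose (K - 1) : ℕ) : ZMod (p ^ 3)) *
          ((K : ℕ) : ZMod (p ^ 3))⁻¹ := by
      have h := congrArg (Nat.cast : ℕ → ZMod (p ^ 3)) (habs i hi)
      simp only [Nat.cast_mul] at h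
      calc (((m * p).choose K : ℕ) : ZMod (p ^ 3))
          = (((m * p).choose K : ℕ) : ZMod (p ^ 3)) * (((K : ℕ) : ZMod (p ^ 3)) * ((K : ℕ) : ZMod (p ^ 3))⁻¹) := by
            rw [hKu, mul_one]
        _ = (((K : ℕ) : ZMod (p ^ 3)) * (((m * p).choose K : ℕ) : ZMod (p ^ 3))) * ((K : ℕ) : ZMod (p ^ 3))⁻¹ := by
            ring
        _ = _ := by rw [h]; push_cast; ring
    push_cast
    rw [e]
    push_cast
    ring
  rw [Nat.cast_sum, Finset.sum_congr rfl hterm, ← Finset.mul_sum]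
  apply sq_mul_eq_zero_of_cast
  rw [map_sum]
  rcases Nat.eq_zero_or_pos A' with hA0 | hA0
  swap
  · -- `A ≥ 3`: every term carries a further factor `p`
    apply Finset.sum_eq_zero
    intro i _
    rw [map_mul, map_pow, map_natCast, ZMod.natCast_self, zero_pow (by omega), zero_mul]
  subst hA0
  -- `A = 2`
  have hp2 : p % 2 = 1 := Nat.odd_iff.mp (hP.odd_of_ne_two (by omega))
  set h := p / 2 with hh
  have hph : p = 2 * h + 1 := by omega
  have hred : ∀ i ∈ Ico 1 p,
      castP ((p : ZMod (p ^ 3)) ^ 0 *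
          (((m : ZMod (p ^ 3)) * (((m * p - 1).choose (j * p + i - 1) : ℕ) : ZMod (p ^ 3)) *
            (((j * p + i : ℕ) : ZMod (p ^ 3)))⁻¹) ^ (0 + 2) *
          ((((m * p + (j * p + i)).choose (j * p + i) : ℕ) : ZMod (p ^ 3)) ^ B *
            ((((2 * (j * p + i)).choose (m * p) : ℕ) : ZMod (p ^ 3))) ^ C))) =
        ((m : ZMod p) ^ 2 * (((m - 1).choose j : ℕ) : ZMod p) ^ 2 * (((m + j).choose j : ℕ) : ZMod p) ^ B) *
          (((if 2 * i < p then (2 * j).choose m else (2 * j + 1).choose m : ℕ) : ZMod p) ^ C) *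
          ((i : ZMod p))⁻¹ ^ 2 := by
    intro i hi
    rw [Finset.mem_Ico] at hi
    rw [pow_zero, one_mul, zero_add, map_mul, map_pow, map_mul, map_mul, map_natCast, map_natCast,
      cast_inv_block j hi.1 hi.2, map_mul, map_pow, map_pow, map_natCast, map_natCast]
    -- Lucas reductions
    have hL1 : (((m * p - 1).choose (j * p + i - 1) : ℕ) : ZMod p) = (((m - 1).choose j : ℕ) : ZMod p) * (-1) ^ (i - 1) := by
      rw [mul_comm m p]; exact cast_choose_mul_sub_one m j i hm hi.1 hi.2
    have hL2 : (((m * p + (j * p + i)).choose (j * p + i) : ℕ) : ZMod p) = (((m + j).choose j : ℕ) : ZMod p) := by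
      have h := cast_choose_shift_digit (p := p) m 0 j i hP.pos hi.2
      rwa [add_zero, zero_add, Nat.choose_self, Nat.cast_one, mul_one] at h
    have hL3 : (((2 * (j * p + i)).choose (m * p) : ℕ) : ZMod p) =
        (((if 2 * i < p then (2 * j).choose m else (2 * j + 1).choose m : ℕ) : ZMod p)) := by
      split_ifs with h2i
      · rw [show 2 * (j * p + i) = 2 * j * p + 2 * i by ring, show m * p = m * p + 0 by ring,
          cast_choose_digit (2 * j) (2 * i) m 0 h2i hP.pos]
        simp
      · rw [show 2 * (j * p + i) = (2 * j + 1) * p + (2 * i - p) by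
              rw [Nat.add_mul, Nat.mul_assoc]; omega,
          show m * p = m * p + 0 by ring, cast_choose_digit (2 * j + 1) (2 * i - p) m 0 (by omega) hP.pos]
        simp
    rw [hL1, hL2, hL3]
    have hsq : ((-1 : ZMod p) ^ (i - 1)) ^ 2 = 1 := by
      rw [← pow_mul, mul_comm, pow_mul, neg_one_sq, one_pow]
    simp only [mul_pow, hsq, mul_one]
    ring
  rw [Finset.sum_congr rfl hred]
  -- split the block at `i = (p−1)/2` and use the two half sums
  obtain ⟨hH1, hH2⟩ := sum_Ico_half_inv_sq_eq_zero (p := p) h3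
  rw [← Finset.sum_Ico_consecutive _ (show 1 ≤ h + 1 by omega) (show h + 1 ≤ p by omega)]
  have hlow : ∀ i ∈ Ico 1 (h + 1),
      ((m : ZMod p) ^ 2 * (((m - 1).choose j : ℕ) : ZMod p) ^ 2 * (((m + j).choose j : ℕ) : ZMod p) ^ B) *
          (((if 2 * i < p then (2 * j).choose m else (2 * j + 1).choose m : ℕ) : ZMod p) ^ C) * ((i : ZMod p))⁻¹ ^ 2 =
        ((m : ZMod p) ^ 2 * (((m - 1).choose j : ℕ) : ZMod p) ^ 2 * (((m + j).choose j : ℕ) : ZMod p) ^ B *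
          (((2 * j).choose m : ℕ) : ZMod p) ^ C) * ((i : ZMod p))⁻¹ ^ 2 := by
    intro i hi
    rw [Finset.mem_Ico] at hi
    rw [if_pos (by omega)]
  have hhigh : ∀ i ∈ Ico (h + 1) p,
      ((m : ZMod p) ^ 2 * (((m - 1).choose j : ℕ) : ZMod p) ^ 2 * (((m + j).choose j : ℕ) : ZMod p) ^ B) *
          (((if 2 * i < p then (2 * j).choose m else (2 * j + 1).choose m : ℕ) : ZMod p) ^ C) * ((i : ZMod p))⁻¹ ^ 2 =
        ((m : ZMod p) ^ 2 * (((m - 1).choose j : ℕ) : ZMod p) ^ 2 * (((m + j).choose j : ℕ) : ZMod p) ^ B *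
          (((2 * j + 1).choose m : ℕ) : ZMod p) ^ C) * ((i : ZMod p))⁻¹ ^ 2 := by
    intro i hi
    rw [Finset.mem_Ico] at hi
    rw [if_neg (by omega)]
  rw [Finset.sum_congr rfl hlow, Finset.sum_congr rfl hhigh, ← Finset.mul_sum, ← Finset.mul_sum,
    show p / 2 + 1 = h + 1 by rfl] at *
  rw [hH1, hH2, mul_zero, mul_zero, add_zero]

/-- Digit terms of `𝒮(mp; A,B,C)`: `C(mp,jp)^A C(mp+jp,jp)^B C(2jp,mp)^C ≡ C(m,j)^A C(m+j,j)^B C(2j,m)^C (mod p³)`.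
[cite: OsburnSahuStraub2016, Theorem 1.2 (r = 1)] [cite: Gessel1982, Thm 3 (proof, «S₁»)] -/
theorem digit_termS_modEq (h3 : 3 < p) (A B C m j : ℕ) :
    (((m * p).choose (j * p) ^ A * (m * p + j * p).choose (j * p) ^ B * (2 * (j * p)).choose (m * p) ^ C : ℕ) : ℤ) ≡
      ((m.choose j ^ A * (m + j).choose j ^ B * (2 * j).choose m ^ C : ℕ) : ℤ) [ZMOD (p : ℤ) ^ 3] := by
  have hP := hp.out
  rw [← Nat.add_mul, ← Nat.mul_assoc]
  push_cast
  exact (((Ljunggren.choose_mul_prime hP h3 m j).pow A).mul ((Ljunggren.choose_mul_prime hP h3 (m + j) j).pow B)).mul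
    ((Ljunggren.choose_mul_prime hP h3 (2 * j) m).pow C)

/-- **Osburn–Sahu–Straub 2016, Theorem 1.2 at `r = 1`, PROVED**: for integers `A ≥ 2`, `B, C ≥ 0`, every `m`
and every prime `p ≥ 5`, `𝒮(mp; A,B,C) ≡ 𝒮(m; A,B,C) (mod p³)`.  In particular (`(A,B,C) = (2,1,1)`) the
sporadic sequence `s₇` satisfies `s₇(mp) ≡ s₇(m) (mod p³)` for `p ≥ 5` (their Conjecture 1.1 for such `p`).
[cite: OsburnSahuStraub2016, Theorem 1.2 (12), r = 1] -/
theorem ossS_mul_prime_modEq (h3 : 3 < p) {A : ℕ} (hA : 2 ≤ A) (B C m : ℕ) :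
    (ossS A B C (m * p) : ℤ) ≡ ossS A B C m [ZMOD (p : ℤ) ^ 3] := by
  have hP := hp.out
  have hdec : ossS A B C (m * p) =
      ∑ j ∈ range m, ((m * p).choose (j * p) ^ A * (m * p + j * p).choose (j * p) ^ B * (2 * (j * p)).choose (m * p) ^ C +
        ∑ i ∈ Ico 1 p, (m * p).choose (j * p + i) ^ A * (m * p + (j * p + i)).choose (j * p + i) ^ B *
          (2 * (j * p + i)).choose (m * p) ^ C) +
      (m * p).choose (m * p) ^ A * (m * p + m * p).choose (m * p) ^ B * (2 * (m * p)).choose (m * p) ^ C := by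
    unfold ossS
    rw [Finset.sum_range_succ, sum_range_mul' _ p m]
    congr 1
    refine Finset.sum_congr rfl fun j _ => ?_
    rw [Finset.range_eq_Ico, Finset.sum_eq_sum_Ico_succ_bot hP.pos, add_zero]
  have hdec' : ossS A B C m =
      ∑ j ∈ range m, m.choose j ^ A * (m + j).choose j ^ B * (2 * j).choose m ^ C +
        m.choose m ^ A * (m + m).choose m ^ B * (2 * m).choose m ^ C := by
    unfold ossS
    rw [Finset.sum_range_succ]
  rw [hdec, hdec']
  push_cast
  refine Int.ModEq.add (Int.ModEq.sum fun j hj => ?_) ?_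
  · have hblock := offDigit_blockS_eq_zero (p := p) h3 hA B C m (Finset.mem_range.1 hj)
    rw [ZMod.natCast_eq_zero_iff] at hblock
    have hblock' : ((∑ i ∈ Ico 1 p, (m * p).choose (j * p + i) ^ A * (m * p + (j * p + i)).choose (j * p + i) ^ B *
        (2 * (j * p + i)).choose (m * p) ^ C : ℕ) : ℤ) ≡ 0 [ZMOD (p : ℤ) ^ 3] := by
      rw [Int.modEq_zero_iff_dvd, ← Nat.cast_pow]
      exact Int.natCast_dvd_natCast.2 hblock
    push_cast at hblock'
    have h := (digit_termS_modEq (p := p) h3 A B C m j).add hblock'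
    rwa [add_zero] at h
  · have h := digit_termS_modEq (p := p) h3 A B C m m
    push_cast at h
    exact h

/-- The case `r = 1` of the named fact `AperyGaussCongruences.oss2016_theorem12`, in its exact shape.
[cite: OsburnSahuStraub2016, Theorem 1.2 (12), r = 1] -/
theorem oss2016_theorem12_r_one (p : ℕ) (hpr : p.Prime) (h5 : 5 ≤ p) (A B C : ℕ) (hA : 2 ≤ A) (m : ℕ) :
    (ossS A B C (m * p ^ 1) : ℤ) ≡ ossS A B C (m * p ^ (1 - 1)) [ZMOD (p : ℤ) ^ (3 * 1)] := by
  haveI : Fact p.Prime := ⟨hpr⟩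
  simpa using ossS_mul_prime_modEq (p := p) (by omega) hA B C m

/-- `s₇(mp) ≡ s₇(m) (mod p³)` for every prime `p ≥ 5` (Osburn–Sahu–Straub's Conjecture 1.1 (9) for `p ≥ 5`,
settled by their Theorem 1.2 at `(A,B,C) = (2,1,1)`, `r = 1`). [cite: OsburnSahuStraub2016, Conjecture 1.1 (9) and the Note after Theorem 1.3] -/
theorem s7_mul_prime_modEq (h3 : 3 < p) (m : ℕ) :
    (AperyGaussCongruences.s7 (m * p) : ℤ) ≡ AperyGaussCongruences.s7 m [ZMOD (p : ℤ) ^ 3] :=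
  ossS_mul_prime_modEq h3 le_rfl 1 1 m

end

end Literature.Combinatorics.Enumerative.MultivariateAperySupercongruenceProofs
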